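import Summits.Ventures.DiscreteObjects.UnitDistance.QuadraticPlanesFourC
import Summits.Ventures.DiscreteObjects.UnitDistance.PlaneSqrt95Four
import Summits.Ventures.DiscreteObjects.UnitDistance.PlaneSqrt179Four
import HarnessLib

/-!
# Quadratic planes with chromatic number four, IV: `d = 95, 179` and the table of `d ≡ 3 (mod 4)` below `100`
(cell `pub-namedobj`, target (U), seat udg g14 — summary)

Framing (verbatim for the cell): lottery ticket; floor = certified bounds/negative ranges.

Two more exact quadratic rows: `χ(ℚ(√95)²) = χ(ℚ(√179)²) = 4` (`PlaneSqrt95Four.lean`: `W₉₅` on `776` vertices, a 594-step kernel RUP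
certificate, upper bound the 7-adic criterion; `PlaneSqrt179Four.lean`: `W₁₇₉` on `768` vertices, a 124-step certificate, upper bound
the 2-adic criterion).  Both witnesses come from radius-4 balls of Cayley graphs of `ℚ(√d)²` whose generators MIX GAUSSIAN CLASSES: a unit
vector `((a + b√d)/n, (c + e√d)/n)` has `n² = m·(s² + d·g²)` with `m = b'² + e'²` the sum of two coprime squares attached to `(b, e)`;
for `95` the denominators `12, 40, 60` carry the classes `m = 1, 5, 25`, for `179` the denominators `30, 130` carry `m = 5` and `m = 65`
(`code/udg14/classes.py`).  CONSEQUENCE (`quadratic_table_three_mod_four_lt_100`): for the twenty-one square-free `d ≡ 3 (mod 4)` below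
`100` the value of `χ(ℚ(√d)²)` is `3` for the thirteen `d ≢ 2 (mod 3)`, `4` for `d = 11, 23, 35, 59, 71, 95`, `∈ {4, 5}` for `d = 47`,
and `∈ {3, 4}` for the single remaining `d = 83` (whose unit vectors have no Gaussian class below `17`; all balls searched so far are
3-colourable).  Ten exact rows with value four are now in the tree (`chromaticNumber_plane_multiSqrtField_eq_four_ten`).  Values `≥ 4`
not found in print (PROVISIONAL).
-/

noncomputable section

namespace Summit.Ventures.DiscreteObjects.UnitDistance

open SimpleGraph IntermediateField
open scoped IntermediateField

/-- TWO MORE EXACT QUADRATIC ROWS: `χ(ℚ(√95)²) = χ(ℚ(√179)²) = 4`. -/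
theorem chromaticNumber_plane_sqrt_95_179 :
    (planeUnitDistanceGraph.induce (fieldPoints ℚ⟮Real.sqrt 95⟯)).chromaticNumber = 4 ∧
    (planeUnitDistanceGraph.induce (fieldPoints ℚ⟮Real.sqrt 179⟯)).chromaticNumber = 4 :=
  ⟨chromaticNumber_plane_sqrt95, chromaticNumber_plane_sqrt179⟩

/-- The ten exact rows with value four known in the tree (`11, 23, 35, 59, 71, 95, 119, 131, 179, 191`), atlas vocabulary. -/
theorem chromaticNumber_plane_multiSqrtField_eq_four_ten :
    ∀ d ∈ ({11, 23, 35, 59, 71, 95, 119, 131, 179, 191} : Finset ℕ),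
      (planeUnitDistanceGraph.induce (fieldPoints (multiSqrtField {d}))).chromaticNumber = 4 := by
  intro d hd
  simp only [Finset.mem_insert, Finset.mem_singleton] at hd
  rcases hd with rfl | rfl | rfl | rfl | rfl | rfl | rfl | rfl | rfl | rfl
  · exact chromaticNumber_plane_multiSqrtField_11
  · exact chromaticNumber_plane_multiSqrtField_23
  · exact chromaticNumber_plane_multiSqrtField_35
  · exact chromaticNumber_plane_multiSqrtField_59
  · exact chromaticNumber_plane_multiSqrtField_71
  · exact chromaticNumber_plane_multiSqrtField_95
  · exact chromaticNumber_plane_multiSqrtField_119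
  · exact chromaticNumber_plane_multiSqrtField_131
  · exact chromaticNumber_plane_multiSqrtField_179
  · exact chromaticNumber_plane_multiSqrtField_191

/-- THE QUADRATIC TABLE FOR SQUARE-FREE `d ≡ 3 (mod 4)` BELOW `100` (twenty-one values): `χ(ℚ(√d)²) = 3` for the thirteen
`d ≢ 2 (mod 3)`, `= 4` for `d = 11, 23, 35, 59, 71, 95`, `4 ≤ χ ≤ 5` for `d = 47`, and for `d = 83` the tree has `3 ≤ χ ≤ 4`
(not 2-colourable, 4-colourable) — the only entry below `100` not decided up to the `47` alternative. -/
theorem quadratic_table_three_mod_four_lt_100 :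
    (∀ d ∈ ({3, 7, 15, 19, 31, 39, 43, 51, 55, 67, 79, 87, 91} : Finset ℕ),
        (planeUnitDistanceGraph.induce (fieldPoints (multiSqrtField {d}))).chromaticNumber = 3) ∧
    (∀ d ∈ ({11, 23, 35, 59, 71, 95} : Finset ℕ),
        (planeUnitDistanceGraph.induce (fieldPoints (multiSqrtField {d}))).chromaticNumber = 4) ∧
    (4 ≤ (planeUnitDistanceGraph.induce (fieldPoints (multiSqrtField {47}))).chromaticNumber ∧
      (planeUnitDistanceGraph.induce (fieldPoints (multiSqrtField {47}))).chromaticNumber ≤ 5) ∧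
    (¬ (planeUnitDistanceGraph.induce (fieldPoints ℚ⟮Real.sqrt 83⟯)).Colorable 2 ∧
      (planeUnitDistanceGraph.induce (fieldPoints ℚ⟮Real.sqrt 83⟯)).Colorable 4) := by
  refine ⟨?_, ?_, chromaticNumber_plane_multiSqrtField_47_bounds, ?_⟩
  · intro d hd
    simp only [Finset.mem_insert, Finset.mem_singleton] at hd
    rcases hd with rfl | rfl | rfl | rfl | rfl | rfl | rfl | rfl | rfl | rfl | rfl | rfl | rfl <;>
      exact chromaticNumber_plane_eq_three_of_mem_mod_four _ (by decide) (Finset.mem_singleton_self _) (by norm_num)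
  · intro d hd
    simp only [Finset.mem_insert, Finset.mem_singleton] at hd
    rcases hd with rfl | rfl | rfl | rfl | rfl | rfl
    · exact chromaticNumber_plane_multiSqrtField_11
    · exact chromaticNumber_plane_multiSqrtField_23
    · exact chromaticNumber_plane_multiSqrtField_35
    · exact chromaticNumber_plane_multiSqrtField_59
    · exact chromaticNumber_plane_multiSqrtField_71
    · exact chromaticNumber_plane_multiSqrtField_95
  · have h := plane_sqrt_three_four_of_mod_eight 83 (by norm_num)
    rw [Nat.cast_ofNat] at h
    exact h

/-- The two new witnesses are triangle-free and not 3-colourable (`χ(W) = 4` for `W₉₅, W₁₇₉` is in the respective files). -/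
theorem witnessesD_triangleFree_not_three_colourable :
    (w95Graph.CliqueFree 3 ∧ ¬ w95Graph.Colorable 3) ∧ (w179Graph.CliqueFree 3 ∧ ¬ w179Graph.Colorable 3) := by
  have h285 : Irrational (Real.sqrt ((285 : ℕ) : ℝ)) :=
    irrational_sqrt_natCast_iff.2 (not_isSquare_of_between (r := 16) (by norm_num) (by norm_num))
  have h95i : Irrational (Real.sqrt ((95 : ℕ) : ℝ)) :=
    irrational_sqrt_natCast_iff.2 (not_isSquare_of_between (r := 9) (by norm_num) (by norm_num))
  have h537 : Irrational (Real.sqrt ((537 : ℕ) : ℝ)) :=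
    irrational_sqrt_natCast_iff.2 (not_isSquare_of_between (r := 23) (by norm_num) (by norm_num))
  have h95 := sqrt3_not_mem_adjoin_sqrt 95 h95i (by convert h285 using 2; push_cast; norm_num)
  have h179 := sqrt3_not_mem_adjoin_sqrt 179 (by norm_num : Nat.Prime 179).irrational_sqrt
    (by convert h537 using 2; push_cast; norm_num)
  rw [Nat.cast_ofNat] at h95 h179
  have tf : ∀ {n : ℕ} {W : SimpleGraph (Fin n)} (K : IntermediateField ℚ ℝ),
      (planeUnitDistanceGraph.induce (fieldPoints K)).CliqueFree 3 →
      (W →g planeUnitDistanceGraph.induce (fieldPoints K)) → W.CliqueFree 3 := by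
    intro n W K hK f s hs
    rw [is3Clique_iff] at hs
    obtain ⟨a, b, c, hab, hac, hbc, -⟩ := hs
    exact hK _ (is3Clique_triple_iff.2 ⟨f.map_rel hab, f.map_rel hac, f.map_rel hbc⟩)
  exact ⟨⟨tf _ (cliqueFree_three_plane_of_sqrt3_not_mem _ h95) w95Hom, not_colorable_three_w95Graph⟩,
    ⟨tf _ (cliqueFree_three_plane_of_sqrt3_not_mem _ h179) w179Hom, not_colorable_three_w179Graph⟩⟩

end Summit.Ventures.DiscreteObjects.UnitDistance
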